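import Mathlib
import Summits.MatrixMultiplication.MatrixMultiplication.Theorems.GradedDesignFamily.Negative.GramTraceRank
import Summits.MatrixMultiplication.MatrixMultiplication.Theorems.GradedDesignFamily.Negative.Mixing

/-!
# Rank expansion from mixing (abstract L1-row theorem)
# (crux `LevelGradedCohnUmans.GradedDesignFamily`, stmt-MatrixMultiplication-7610; negative side,
# line `quadratic-extension-level-one-cell`, stub `card_mul_sq_le_finrank_mul_of_mixing`)

Abstract form of the L1-row theorem of the line's negative programme.  Let `inc ⊆ L × P` be an
incidence relation between "lines" `l ∈ L` and "points" `p ∈ P` such that every line has exactly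
`m` points and two distinct lines share at most one point, and let `A` be the `0/1` "meeting" matrix
of distinct lines (`A l l' = 1` iff `l ≠ l'` and `l`, `l'` have a common point), with constant row
sums `k` (`A 𝟙 = k 𝟙`) and quadratic form bounded by `θ` on the vectors of coordinate sum zero.
Then for every set `S` of lines, writing `s := |S|`, `n := |L|` and `1_l ∈ ℝ^P` for the indicator
function of the points of `l`,

* `card_mul_sq_le_finrank_mul_of_mixing` —
  `(s m)² ≤ dim span {1_l : l ∈ S} · (m² s + k s² / n + θ (s - s² / n))`.

For the lines of `PG(3,q)` (`m = q + 1`, `k = q (q + 1)²`, `θ = q² - 1`) and `s = C q³` this is the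
rank expansion `dim span {1_l : l ∈ S} ≥ (C / (C + 2)) (q³ + q²)`.

Proof (composition of the two engines of the line).
(1) `sum_sq_sq_le_finrank_mul_sum_gram_sq` for the family `v : ↥S → ℝ^P`, `v l := 1_l`, gives
`(Σ_{l ∈ S} ‖1_l‖²)² ≤ dim span {1_l} · Σ_{l,l' ∈ S} ⟨1_l, 1_{l'}⟩²`.
(2) `‖1_l‖² = m` (each line has `m` points), so the left-hand side is `(s m)²`.
(3) `⟨1_l, 1_{l'}⟩ = #(l ∩ l')`, which is `m` for `l = l'` and `∈ {0, 1}` for `l ≠ l'`, where it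
equals `A l l'`; since moreover `A l l = 0`, `Σ_{l,l' ∈ S} ⟨1_l, 1_{l'}⟩² = m² s + 1_S ⬝ A 1_S`.
(4) `indicator_mulVec_le_of_rayleigh` (expander mixing; `A` is symmetric because its defining
formula is) bounds `1_S ⬝ A 1_S ≤ k s² / n + θ (s - s² / n)`.
(5) Multiply (4) by `dim span {1_l} ≥ 0` and chain with (1)–(3).

Sorry-free; axioms `propext`, `Classical.choice`, `Quot.sound`.
-/

set_option linter.dupNamespace false

open scoped BigOperators

namespace Summit.MatrixMultiplication.MatrixMultiplication.Theorems.GradedDesignFamily.Negative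

/-- Gram entries of the line indicators: `⟨1_l, 1_{l'}⟩ = #{p | inc l p ∧ inc l' p}`. -/
private theorem card_mul_sq_le_finrank_mul_of_mixing_gram {L P : Type} [Fintype P]
    (inc : L → P → Prop) [∀ l p, Decidable (inc l p)] (l l' : L) :
    ∑ p, (if inc l p then (1 : ℝ) else 0) * (if inc l' p then (1 : ℝ) else 0) =
      ((Finset.univ.filter fun p => inc l p ∧ inc l' p).card : ℝ) := by
  simp_rw [ite_zero_mul_ite_zero, mul_one]
  rw [Finset.sum_boole]

/-- Squared norms of the line indicators: `‖1_l‖² = m` when every line has `m` points. -/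
private theorem card_mul_sq_le_finrank_mul_of_mixing_norm_sq {L P : Type} [Fintype P]
    (inc : L → P → Prop) [∀ l p, Decidable (inc l p)] (m : ℕ)
    (hm : ∀ l : L, (Finset.univ.filter fun p => inc l p).card = m) (l : L) :
    ∑ p, (if inc l p then (1 : ℝ) else 0) ^ 2 = (m : ℝ) := by
  simp_rw [sq, card_mul_sq_le_finrank_mul_of_mixing_gram inc l l, and_self]
  rw [hm l]

/-- Squared Gram entries in terms of the meeting matrix:
`⟨1_l, 1_{l'}⟩² = m² [l = l'] + A l l'` (two distinct lines share `≤ 1` point, `A l l = 0`). -/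
private theorem card_mul_sq_le_finrank_mul_of_mixing_gram_sq {L P : Type} [Fintype P]
    [DecidableEq L] (inc : L → P → Prop) [∀ l p, Decidable (inc l p)] (A : Matrix L L ℝ) (m : ℕ)
    (hm : ∀ l : L, (Finset.univ.filter fun p => inc l p).card = m)
    (h1 : ∀ l l' : L, l ≠ l' → (Finset.univ.filter fun p => inc l p ∧ inc l' p).card ≤ 1)
    (hA : ∀ l l' : L, A l l' = if l ≠ l' ∧ (∃ p, inc l p ∧ inc l' p) then 1 else 0) (l l' : L) :
    (∑ p, (if inc l p then (1 : ℝ) else 0) * (if inc l' p then (1 : ℝ) else 0)) ^ 2 =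
      (if l = l' then (m : ℝ) ^ 2 else 0) + A l l' := by
  rw [card_mul_sq_le_finrank_mul_of_mixing_gram inc l l', hA l l']
  by_cases hll : l = l'
  · subst hll
    simp_rw [and_self]
    rw [hm l]
    simp
  · by_cases hex : ∃ p, inc l p ∧ inc l' p
    · have hpos : 0 < (Finset.univ.filter fun p => inc l p ∧ inc l' p).card := by
        obtain ⟨p, hp⟩ := hex
        exact Finset.card_pos.2 ⟨p, by simpa using hp⟩
      have hone : (Finset.univ.filter fun p => inc l p ∧ inc l' p).card = 1 :=
        le_antisymm (h1 l l' hll) hpos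
      rw [hone, if_neg hll, if_pos ⟨hll, hex⟩]
      norm_num
    · have hzero : (Finset.univ.filter fun p => inc l p ∧ inc l' p) = ∅ :=
        Finset.filter_eq_empty_iff.2 fun p _ hp => hex ⟨p, hp⟩
      rw [hzero, if_neg hll, if_neg fun h => hex h.2]
      simp

/-- The quadratic form of `A` at the indicator vector of `S`: `1_S ⬝ A 1_S = Σ_{l,l' ∈ S} A l l'`. -/
private theorem card_mul_sq_le_finrank_mul_of_mixing_quad {L : Type} [Fintype L] [DecidableEq L]
    (A : Matrix L L ℝ) (S : Finset L) :
    dotProduct (fun v => if v ∈ S then (1 : ℝ) else 0)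
        (A.mulVec fun v => if v ∈ S then (1 : ℝ) else 0) = ∑ l ∈ S, ∑ l' ∈ S, A l l' := by
  simp only [dotProduct, Matrix.mulVec, boole_mul, mul_boole, Finset.sum_ite_mem_eq]

/-- The meeting matrix is symmetric (its defining formula is symmetric in `l`, `l'`). -/
private theorem card_mul_sq_le_finrank_mul_of_mixing_isSymm {L P : Type} [Fintype P]
    [DecidableEq L] (inc : L → P → Prop) [∀ l p, Decidable (inc l p)] (A : Matrix L L ℝ)
    (hA : ∀ l l' : L, A l l' = if l ≠ l' ∧ (∃ p, inc l p ∧ inc l' p) then 1 else 0) :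
    A.IsSymm :=
  Matrix.IsSymm.ext fun i j => by
    rw [hA i j, hA j i]
    exact if_congr
      ⟨fun ⟨h, p, hp, hq⟩ => ⟨Ne.symm h, p, hq, hp⟩, fun ⟨h, p, hp, hq⟩ => ⟨Ne.symm h, p, hq, hp⟩⟩
      rfl rfl

/-- **Rank expansion from mixing** (abstract L1-row theorem).  Lines with `m` points each, two
distinct lines sharing `≤ 1` point, meeting matrix `A` with `A 𝟙 = k 𝟙` and `x ⬝ A x ≤ θ (x ⬝ x)` on
`𝟙^⊥`: for every line set `S`,
`(|S| m)² ≤ dim span {1_l : l ∈ S} · (m² |S| + k |S|² / |L| + θ (|S| - |S|² / |L|))`. [folklore] -/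
theorem card_mul_sq_le_finrank_mul_of_mixing :
    ∀ {L P : Type} [Fintype L] [Fintype P] [DecidableEq L] [DecidableEq P]
      (inc : L → P → Prop) [∀ l p, Decidable (inc l p)] (A : Matrix L L ℝ) (m : ℕ) (k θ : ℝ),
      (∀ l : L, (Finset.univ.filter fun p => inc l p).card = m) →
      (∀ l l' : L, l ≠ l' → (Finset.univ.filter fun p => inc l p ∧ inc l' p).card ≤ 1) →
      (∀ l l' : L, A l l' = if l ≠ l' ∧ (∃ p, inc l p ∧ inc l' p) then 1 else 0) →
      (A.mulVec (fun _ => 1) = fun _ => k) →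
      (∀ x : L → ℝ, ∑ l, x l = 0 → dotProduct x (A.mulVec x) ≤ θ * dotProduct x x) →
      ∀ S : Finset L,
        ((S.card * m : ℕ) : ℝ) ^ 2 ≤
          (Module.finrank ℝ (Submodule.span ℝ
              ((fun l : L => fun p : P => if inc l p then (1 : ℝ) else 0) '' (S : Set L))) : ℝ) *
            ((m : ℝ) ^ 2 * S.card + k * (S.card : ℝ) ^ 2 / Fintype.card L +
              θ * ((S.card : ℝ) - (S.card : ℝ) ^ 2 / Fintype.card L)) := by
  intro L P _ _ _ _ inc _ A m k θ hm h1 hA hk hθ S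
  -- the family of indicator functions of the lines of `S`, indexed by the subtype `↥S`
  let v : S → P → ℝ := fun i p => if inc (i : L) p then (1 : ℝ) else 0
  have hrange :
      Set.range v = (fun l : L => fun p : P => if inc l p then (1 : ℝ) else 0) '' (S : Set L) := by
    ext g
    constructor
    · rintro ⟨⟨l, hl⟩, rfl⟩
      exact ⟨l, hl, rfl⟩
    · rintro ⟨l, hl, rfl⟩
      exact ⟨⟨l, hl⟩, rfl⟩
  -- (2) `Σ_{l ∈ S} ‖1_l‖² = |S| m`
  have hsum1 : ∑ i, ∑ p, v i p ^ 2 = (S.card : ℝ) * m := by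
    calc ∑ i, ∑ p, v i p ^ 2 = ∑ _i : S, (m : ℝ) :=
          Finset.sum_congr rfl fun i _ =>
            card_mul_sq_le_finrank_mul_of_mixing_norm_sq inc m hm (i : L)
      _ = (S.card : ℝ) * m := by simp
  -- (3) `Σ_{l,l' ∈ S} ⟨1_l, 1_{l'}⟩² = m² |S| + 1_S ⬝ A 1_S`
  have hsum2 : ∑ i, ∑ j, (∑ p, v i p * v j p) ^ 2 =
      (m : ℝ) ^ 2 * S.card + dotProduct (fun v => if v ∈ S then (1 : ℝ) else 0)
        (A.mulVec fun v => if v ∈ S then (1 : ℝ) else 0) := by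
    calc ∑ i, ∑ j, (∑ p, v i p * v j p) ^ 2
        = ∑ i : S, ∑ j : S, ((if (i : L) = j then (m : ℝ) ^ 2 else 0) + A i j) :=
          Finset.sum_congr rfl fun i _ => Finset.sum_congr rfl fun j _ =>
            card_mul_sq_le_finrank_mul_of_mixing_gram_sq inc A m hm h1 hA (i : L) (j : L)
      _ = ∑ l ∈ S, ∑ l' ∈ S, ((if l = l' then (m : ℝ) ^ 2 else 0) + A l l') := by
          rw [← Finset.sum_coe_sort S]
          exact Finset.sum_congr rfl fun i _ =>
            Finset.sum_coe_sort S fun l' => (if (i : L) = l' then (m : ℝ) ^ 2 else 0) + A i l'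
      _ = (m : ℝ) ^ 2 * S.card + ∑ l ∈ S, ∑ l' ∈ S, A l l' := by
          simp only [Finset.sum_add_distrib, Finset.sum_ite_eq, Finset.sum_ite_mem,
            Finset.inter_self, Finset.sum_const, nsmul_eq_mul]
          ring
      _ = _ := by rw [card_mul_sq_le_finrank_mul_of_mixing_quad A S]
  -- (1) the Gram trace–rank inequality, rewritten with (2) and (3)
  have hGram := sum_sq_sq_le_finrank_mul_sum_gram_sq v
  rw [hrange, hsum1, hsum2] at hGram
  -- (4) expander mixing
  have hmix := indicator_mulVec_le_of_rayleigh A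
    (card_mul_sq_le_finrank_mul_of_mixing_isSymm inc A hA) k θ hk hθ S
  -- (5) chain
  rw [Nat.cast_mul, add_assoc]
  exact hGram.trans (mul_le_mul_of_nonneg_left (add_le_add le_rfl hmix) (Nat.cast_nonneg _))

end Summit.MatrixMultiplication.MatrixMultiplication.Theorems.GradedDesignFamily.Negative
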